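import Summits.ValiantsHypothesis.ValiantsHypothesis.Theorems.KPlusLogSqLawOctaveDominatedClasses

/-!
# Route «KPlusLogSqLaw», octave line — the rung is BASIS-FREE: conjugation `S_l ↦ G S_l H` and `basisFreeOctaveLifting_proof`

HONEST FRAMING.  Prover seat val-width-19561-oc1 (g2), `--supports stmt-ValiantsHypothesis-19561`.  `OctaveWeakLifting` (Ω-W),
`WeakLifting` (stmt-19561), `TropicalB` (stmt-19771), Conjecture B are OPEN; `DeadClassLifting`, `LiveBreaksBound`, `NewtonBreakLifting`
are DEFINED elsewhere, NOT asserted.  Nothing here bears on their truth; VP ≠ VNP is not moved.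

WHY THIS FILE (the located open point of the depth-free direction, g0: MASKING by dead classes).  The rung `shallowOctaveLifting_proof`
and its dominated-class strengthening `dominatedClassLifting_proof` read the DESIGN envelope of the raw Leibniz expansion of
`F(x) = Σ_l x^{d_l} S_l`, which depends on the chosen bases of source and target — while the roots of `det F` do not.  The cheapest
masking mechanism («invisible resonant roof», this seat's analysis, `Cruxes/WeakLifting/Lines/octave-masking.md`): parallel rank-one
letters `H_a x^{δ_a} v vᵀ` added to a pencil whose letters satisfy `vᵀ adj(S_b) v = 0` leave `det` unchanged
(`det(F + h v vᵀ) = det F + h · vᵀ adj(F) v`) but put huge raw terms into every resonant live class, so `DepthLE` / `TopDepthLE` fail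
and the live envelope acquires breakpoints that `det F` knows nothing about.  After the change of bases `v ↦ e₁` on both sides the roof
letters become multiples of `E₁₁` and the ordinary letters lose their `(1,1)` entry: the roof then occurs in NO raw Leibniz term at all,
and the conjugated pencil is shallow again.  This file records the kernel form of that remark: the conclusion of the rung holds for `S`
as soon as SOME conjugate `(G S_l H)_l` (`det G, det H ≠ 0`) satisfies the depth hypothesis (conjugated letters are written `fun l => G * S l * H`) — `pencilDet_conj`
(`det(Σ x^{d_l} G S_l H) = C(det G · det H) · det(Σ x^{d_l} S_l)`), `octaveCount_C_mul`, `basisFreeOctaveLifting_proof` (from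
`DepthLE` of a conjugate) and `basisFreeDominatedLifting_proof` (from `TopDepthLE` of a conjugate).  Consequence for the open point: a
counterexample to dead-class / Newton-break lifting must mask in EVERY pair of bases simultaneously.  [folklore linear algebra]
-/

set_option linter.dupNamespace false
set_option autoImplicit false

namespace Summit.ValiantsHypothesis.ValiantsHypothesis.Theorems.KPlusLogSqLaw.Octave

open Polynomial Finset
open scoped BigOperators

section Conjugation

variable {m K : ℕ}

/-- the pencil of the conjugated letters is the conjugated pencil. [folklore] -/
theorem pencil_conj (G H : Matrix (Fin m) (Fin m) ℝ) (d : Fin K → ℕ) (S : Fin K → Matrix (Fin m) (Fin m) ℝ) :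
    (∑ l, ((Polynomial.X : Polynomial ℝ) ^ d l) • (G * S l * H).map Polynomial.C) =
      G.map Polynomial.C * (∑ l, ((Polynomial.X : Polynomial ℝ) ^ d l) • (S l).map Polynomial.C) * H.map Polynomial.C := by
  rw [Finset.mul_sum, Finset.sum_mul]
  refine Finset.sum_congr rfl fun l _ => ?_
  rw [Matrix.map_mul, Matrix.map_mul, Matrix.mul_smul, Matrix.smul_mul]

/-- **conjugation multiplies the pencil determinant by a nonzero constant**:
`det(Σ x^{d_l} G S_l H) = C(det G · det H) · det(Σ x^{d_l} S_l)`. [folklore] -/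
theorem pencilDet_conj (G H : Matrix (Fin m) (Fin m) ℝ) (d : Fin K → ℕ) (S : Fin K → Matrix (Fin m) (Fin m) ℝ) :
    pencilDet d (fun l => G * S l * H) = Polynomial.C (G.det * H.det) * pencilDet d S := by
  unfold pencilDet
  rw [pencil_conj, Matrix.det_mul, Matrix.det_mul]
  have hG : (G.map Polynomial.C).det = Polynomial.C G.det := by
    rw [show G.map (Polynomial.C : ℝ → Polynomial ℝ) = (Polynomial.C : ℝ →+* Polynomial ℝ).mapMatrix G from rfl,
      ← RingHom.map_det]
  have hH : (H.map Polynomial.C).det = Polynomial.C H.det := by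
    rw [show H.map (Polynomial.C : ℝ → Polynomial ℝ) = (Polynomial.C : ℝ →+* Polynomial ℝ).mapMatrix H from rfl,
      ← RingHom.map_det]
  rw [hG, hH, Polynomial.C_mul]
  ring

/-- the octave count is blind to nonzero constant factors. [folklore] -/
theorem octaveCount_C_mul (c : ℝ) (hc : c ≠ 0) (p : Polynomial ℝ) : octaveCount (Polynomial.C c * p) = octaveCount p := by
  unfold octaveCount
  rw [Polynomial.roots_C_mul p hc]

/-- hence the octave count of a pencil is a conjugation invariant. [folklore] -/
theorem octaveCount_pencilDet_conj (G H : Matrix (Fin m) (Fin m) ℝ) (hG : G.det ≠ 0) (hH : H.det ≠ 0)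
    (d : Fin K → ℕ) (S : Fin K → Matrix (Fin m) (Fin m) ℝ) :
    octaveCount (pencilDet d (fun l => G * S l * H)) = octaveCount (pencilDet d S) := by
  rw [pencilDet_conj, octaveCount_C_mul _ (mul_ne_zero hG hH)]

/-- **basis-free rung** (PROVED): if SOME conjugate `(G S_l H)_l` of the pencil has cancellation depth `≤ Δ`, the rung's bound holds
for the pencil itself — the roots do not see the bases, the design envelope does. [folklore] -/
theorem basisFreeOctaveLifting_proof (m K n Δ : ℕ)
    (hT : Summit.ValiantsHypothesis.ValiantsHypothesis.Theorems.KPlusLogSqLaw.TropRowD m K n)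
    (d : Fin K → ℕ) (S : Fin K → Matrix (Fin m) (Fin m) ℝ) (G H : Matrix (Fin m) (Fin m) ℝ)
    (hG : G.det ≠ 0) (hH : H.det ≠ 0) (hΔ : DepthLE d (fun l => G * S l * H) Δ) :
    octaveCount (pencilDet d S) ≤ (2 * (m * (Nat.log 2 (m * K) + 1) + Δ) + 3) * (n + 1) := by
  rw [← octaveCount_pencilDet_conj G H hG hH d S]
  exact shallowOctaveLifting_of designPiecesBound_proof rootNearBreakpoint_proof cellCount_proof m K n Δ hT d _ hΔ

/-- **basis-free dominated-class lifting** (PROVED): the same with the weaker hypothesis `TopDepthLE` (depth only for classes reaching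
the top of the design envelope) on some conjugate. [folklore] -/
theorem basisFreeDominatedLifting_proof (m K n Δ : ℕ)
    (hT : Summit.ValiantsHypothesis.ValiantsHypothesis.Theorems.KPlusLogSqLaw.TropRowD m K n)
    (d : Fin K → ℕ) (S : Fin K → Matrix (Fin m) (Fin m) ℝ) (G H : Matrix (Fin m) (Fin m) ℝ)
    (hG : G.det ≠ 0) (hH : H.det ≠ 0) (hΔ : TopDepthLE d (fun l => G * S l * H) Δ) :
    octaveCount (pencilDet d S) ≤ (2 * (m * (Nat.log 2 (m * K) + 1) + Δ) + 3) * (n + 1) := by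
  rw [← octaveCount_pencilDet_conj G H hG hH d S]
  exact dominatedClassLifting_proof m K n Δ hT d _ hΔ

/-- and with live depth plus «no dead class of the conjugate reaches the top». [folklore] -/
theorem basisFreeDeadClassLifting_of_dominated (m K n Δ : ℕ)
    (hT : Summit.ValiantsHypothesis.ValiantsHypothesis.Theorems.KPlusLogSqLaw.TropRowD m K n)
    (d : Fin K → ℕ) (S : Fin K → Matrix (Fin m) (Fin m) ℝ) (G H : Matrix (Fin m) (Fin m) ℝ)
    (hG : G.det ≠ 0) (hH : H.det ≠ 0) (hlive : LiveDepthLE d (fun l => G * S l * H) Δ)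
    (hdom : ∀ e, IsDeadClass d (fun l => G * S l * H) e → ¬ IsTopClass d (fun l => G * S l * H) e) :
    octaveCount (pencilDet d S) ≤ (2 * (m * (Nat.log 2 (m * K) + 1) + Δ) + 3) * (n + 1) := by
  rw [← octaveCount_pencilDet_conj G H hG hH d S]
  exact deadClassLifting_of_dominated m K n Δ hT d _ hlive hdom

end Conjugation

end Summit.ValiantsHypothesis.ValiantsHypothesis.Theorems.KPlusLogSqLaw.Octave
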